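import Summits.BirchSwinnertonDyer.BirchSwinnertonDyer.Theorems.GoldfeldK12AdditiveTwoHalfTraceCore
import Summits.BirchSwinnertonDyer.BirchSwinnertonDyer.Theorems.GoldfeldAllTwistsTwoConverseTwinBirchLemma
import Literature.NumberTheory.EllipticCurves.GoodReductionInertia
import HarnessLib

set_option linter.dupNamespace false -- namespace `…BirchSwinnertonDyer.BirchSwinnertonDyer…` is the cell's (D-0017 nested layout)
set_option autoImplicit false

/-!
# The even-discriminant Birch lemma for `X₀(49)` at `4`-rank zero: the HALF-TRACE argument
# (clause (i) of LINE B49 for the primes `q ≡ 5 (mod 8)`), algebraic core PROVED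

Cell `bsd-goldfeld`, seat `bsd-goldfeld-s1p-c201` (prover, gen 6), `--supports stmt-BirchSwinnertonDyer-20044`
(route decl `Summit.BirchSwinnertonDyer.BirchSwinnertonDyer.Theses.GoldfeldAllTwistsTwoConverse.RankOneTwoConverseCMSevenAdditiveTwo`,
K12₂″). HONEST FRAMING: nothing here proves K12₂″ or BSD; the theorems of §5 conclude `ord_{s=1} L = 1`
for the INFINITE sub-family `49a1^{(−q)}`, `q ≡ 5 (mod 8)` prime, `(q/7) = −1`, of the additive cell —
conditional on ONE named input (`X049GenusHalfTraceFiveModEight`, §4) assembling printed facts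
(Gross 1984 §5 / Gross 1991 Prop. 5.3, Shimura reciprocity, Gauss genus theory, the Manin constant of
`49a1`, and the ramification of `ℚ(i, √−q)` at `q`), plus Modularity, Gross–Zagier, Heegner rationality and
Coates–Li–Tian–Zhai Thm. 1.2 at `R = 1` exactly as in seat c301's B49 consumers.

## The argument (memo `HOME/BIRCH-HALFTRACE.md`; numerics kit `j259794`, evidence on item 20044)

`E₀ = X₀(49) = cm7 : y² + xy = x³ − x² − 2x − 1`, `T = (2, −1)` its rational `2`-torsion point (the image of
the cusp `0`; `L(E₀,1)/Ω = 1/2`). `q ≡ 5 (mod 8)` prime with `(q/7) = −1`, `K = ℚ(√−q)` (`d_K = −4q`,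
`h_K ≡ 2 (mod 4)`, genus field `H₀ = K(i) = ℚ(i, √−q)` with `Gal(H₀/ℚ) = {1, ρ, τ, ρτ}`, `τ` = complex
conjugation, `ρ` the generator of `Gal(H₀/K)`). Let `x ∈ E₀(H)` be a level-`49` Heegner point over the
Hilbert class field and `z := Σ_{σ ∈ Gal(H/K)²} x^σ ∈ E₀(H₀)` the HALF-TRACE over the SQUARE classes
(`#Gal(H/K)² = h/2` odd). Then `y_K = z + ρz` is the Heegner point over `K`, and

  (HT)  `z + τz = T`

(Gross: `τx = −σ'x + T` with `σ' = rec[𝔫]`, `𝔫 = 𝔮²` a square because `N = 49` is; summing over the odd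
number `h/2` of square classes). If `y_K` were torsion, §3's `2`-torsion bookkeeping (`E₀(H₀)[2] = ⟨T⟩`
since `√−7 ∉ H₀`) reduces to `z' + ρz' ∈ {O, T}` for an odd/2-power multiple `z'` still satisfying (HT)
or its double, and the ABSTRACT HALF-TRACE LEMMA (§1) leaves two cases:
* Case I (`z' + ρz' = T`): `ρτ z' = z'`, so `z' ∈ E₀(ℚ(i))` with `z' + z̄' = T` — excluded by the
  `2`-isogeny descent over the Gaussian field (§3): it would put `−1` into `S'(−21, 112) = S(42, −7) ⊆ {1, −7}`
  (seat c301's `mem_of_mem_twoIsogenySelmerGroup'_inertTwist` at `m = 1`, tree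
  `range_xSqClass_subset_image_twoIsogenySelmerGroup`);
* Case II (`z' + ρz' = O`): `ρτ z' = z' + T` — excluded by INERTIA at `q` (§2): `ρτ` generates the inertia
  group at `q` of `H₀/ℚ`, `E₀` has good reduction at `q ∤ 14`, and `2(z'^{ρτ} − z') = O` forces
  `z'^{ρτ} = z'` (tree `map_eq_of_inertia_of_zsmul_sub_eq_zero`, Silverman VIII.1.5(b)/X.4.2(b)).
Hence `y_K` has infinite order; Gross–Zagier gives `ord L(X₀(49)/K) = 1`, i.e. «Conjecture D(q)»
`ord L(49a1^{(−q)}) = 1` (c301's dictionary), the conclusion of K12₂″ on this family.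

What is NOT here: the primes `q ≡ 1 (mod 8)` (`4`-rank one: (HT) degenerates to `z + τz = O`); the
construction of the genus-field datum (§4 is a named input, every conjunct sourced in its docstring).
PARTITION: none — RANK axis (S1⁺), the inert prime family of K12PP-RINGCLASS §6 / TARGET §2 c301 B49.

References: [Gross1984] §5; [GrossLMS1991] Prop. 5.3 and proof (PDF p. 220 of the held volume);
[Darmon2004] Thm. 3.7, Prop. 3.11; [CoatesLiTianZhai2015] Thm. 2.2, Cor. 2.3 (odd class number case),
Thm. 1.2, 1.4; [GrossZagier1986] I.(6.3); [SilvermanAEC2009] VIII.1.5(b), X.4.9; [Monsky1990] (X₀(32)).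
-/

noncomputable section

open scoped Classical NNReal

namespace Summit.BirchSwinnertonDyer.BirchSwinnertonDyer.Theorems.GoldfeldGoodTwists

open WeierstrassCurve NumberField Literature.NumberTheory Literature.NumberTheory.EllipticCurves
  Literature.NumberTheory.EllipticCurves.ModularForms

/-! ## §4 The input: the genus-field half-trace datum (Gross 1984 §5 + genus theory), NAMED, not asserted -/

/-- **The genus-field half-trace datum** attached to a Heegner point `P ∈ X₀(49)(K)`, `K = ℚ(√−q)`,
`q ≡ 5 (mod 8)`, `(q/7) = −1`, and a Manin constant `c` (hypothesis structure; its EXISTENCE is the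
named input `X049GenusHalfTraceFiveModEight`). The intended witness, conjunct by conjunct:
* `L = H₀ = K(i) = ℚ(i, √−q)`, the genus field of `K` (`d_K = −4q = (−4)·(q)`; Gauss); `j : K → L`;
  `τ` = complex conjugation of `L` (w.r.t. the embedding extending the Heegner datum's `ι`), `ρ` = the
  generator of `Gal(L/K)`; `i = √−1 ∈ L` with `τ i = −i`; the fixed field of `ρτ` is `ℚ(i)`, whence
  `fixed_ratSpan`; `√−7 ∉ L` (`q ≠ 7`), whence `seven`.
* `w` = the valuation of `L` at a prime above `q` (normalised into `ℝ≥0`): `ρτ` generates the inertia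
  group there (`q` is ramified in `ℚ(√−q)` and `ℚ(√q)`, unramified in `ℚ(i)`; each prime of `ℚ(i)` above
  `q` is totally ramified in `L`), whence `val_map`, `val_inertia`; `w(2) = w(7) = 1` as `q ∤ 14`.
* `Φ : X₀(49)(L) → E₊(L)` = the isomorphism of the change of variables `C₁` (`smul_cm7_eq_twoTorsionModel`,
  `(x, y) ↦ (4(x − 2), 8y + 4x)`, `T = (2,−1) ↦ T₊ = (0,0)`; tree `VariableChange.pointEquivBaseChange`,
  Galois-equivariant by `pointEquivBaseChange_map_algEquiv`).
* `y₀ ∈ X₀(49)(K)` = the level-`49` Heegner point of the OPTIMAL parametrisation (Manin constant `1` for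
  `49a1`: Cremona's tables / Edixhoven), so that `P = c • y₀` for the datum's constant `c`
  (`heegnerPointComplex Dt H = Dt.c • (optimal trace)`, `uniformize` being additive).
* `z ∈ E₊(L)` = `Φ` of the HALF-TRACE `Σ_{σ ∈ Gal(H/K)²} x^σ` of a Heegner point `x` over the Hilbert
  class field `H` (Shimura reciprocity, Darmon Thm. 3.7: `Gal(H/K) ≅ Cl(K)` permutes the `h` points
  `φ(τ_Q)` simply transitively; the squares `Cl(K)²` have index `2` and ODD order `h/2` because
  `Cl(K)[2^∞] ≅ ℤ/2` for `d_K = −4q`, `q ≡ 5 (mod 8)` — Gauss genus theory / Rédei), so that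
  `y₀ = z + ρz` (`halfTrace`) and — the HEART — `z + τz = T₊` (`halfTrace_conj`): Gross 1984 §5 /
  Gross 1991 Prop. 5.3 with its proof ("`(x − ∞)^τ = w_N(x − ∞)^{σ'} + (w_N∞ − ∞)`", `w_N ∞` = the
  cusp `0`, whose class is `T = (2, −1)` on `X₀(49)`: `L(E₀,1)/Ω⁺ = 1/2`; `w₄₉` acts on `E₀` by `−1`
  since the sign of `L(E₀, s)` is `+1`; `σ' = rec[𝔫]`, `𝔫 = 𝔮²` a SQUARE class because `N = 49` is a
  square, so conjugation preserves the half-trace over `Cl(K)²` and contributes `(h/2)·T = T`).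
Numerical confirmation (kit j259794, item 20044 evidence): `z + z̄ = T` to `10⁻³⁶` for
`q = 5, 13, 61, 101, 173, 229`, and `z + z̄ = O` for `q ≡ 1 (mod 8)` as the parity `h/2` predicts.
[cite: GrossLMS1991, Prop. 5.3 and its proof] [cite: Darmon2004, Thm. 3.7 and Prop. 3.11]
[cite: CoatesLiTianZhai2015, §2 (h2) and Thm. 2.2 (odd class number case)] -/
structure X049GenusHalfTraceDatum (K : Type) [Field K] [NumberField K] (c : ℤ)
    (P : (cm7.baseChange K).toAffine.Point) where
  /-- The genus field `L = K(i) = ℚ(i, √−q)` (any model). -/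
  L : Type
  [instField : Field L]
  [instCharZero : CharZero L]
  /-- The inclusion `K → L`. -/
  j : K →+* L
  /-- The generator `ρ` of `Gal(L/K)`. -/
  ρ : L ≃ₐ[ℚ] L
  /-- Complex conjugation `τ` on `L`. -/
  τ : L ≃ₐ[ℚ] L
  /-- `i = √−1 ∈ L`. -/
  i : L
  /-- A valuation of `L` above `q`. -/
  w : Valuation L ℝ≥0
  /-- The transport `X₀(49)(L) → E₊(L)` along `C₁`. -/
  Φ : (cm7.baseChange L).toAffine.Point →+ ((⟨0, 21, 0, 112, 0⟩ : WeierstrassCurve ℚ).baseChange L).toAffine.Point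
  /-- The optimal Heegner trace `y₀ ∈ X₀(49)(K)`. -/
  y₀ : (cm7.baseChange K).toAffine.Point
  /-- The half-trace `z ∈ E₊(L)`. -/
  z : ((⟨0, 21, 0, 112, 0⟩ : WeierstrassCurve ℚ).baseChange L).toAffine.Point
  /-- `i² = −1`. -/
  i_sq : i ^ 2 = -1
  /-- `τ i = −i`. -/
  map_i : τ i = -i
  /-- The fixed field of `ρτ` is `ℚ(i) = ℚ ⊕ ℚ i`. -/
  fixed_ratSpan : ∀ x : L, ρ (τ x) = x → ∃ u v : ℚ, x = u + v * i
  /-- `√−7 ∉ L`. -/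
  seven : ∀ x : L, x ^ 2 ≠ -7
  /-- `ρτ` preserves `w`. -/
  val_map : ∀ x : L, w (ρ (τ x)) = w x
  /-- `ρτ` lies in the inertia group of `w`. -/
  val_inertia : ∀ x : L, w x ≤ 1 → w (ρ (τ x) - x) < 1
  /-- `w(2) = 1` (`q` odd). -/
  val_two : w 2 = 1
  /-- `w(7) = 1` (`q ≠ 7`). -/
  val_seven : w 7 = 1
  /-- `Φ` is injective (an isomorphism of groups in the intended witness). -/
  injective : Function.Injective Φ
  /-- `P = c • y₀` (Manin constant). -/
  smul_eq : P = c • y₀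
  /-- `y₀ = z + ρ z` in `E₊(L)`: the trace is the half-trace plus its `ρ`-conjugate. -/
  halfTrace : Φ (Affine.Point.map j.toRatAlgHom y₀) = z + Affine.Point.map (ρ : L →ₐ[ℚ] L) z
  /-- THE HALF-TRACE RELATION `z + τ z = T₊` (Gross 1984 §5 + genus theory at `4`-rank zero). -/
  halfTrace_conj : z + Affine.Point.map (τ : L →ₐ[ℚ] L) z =
    Affine.Point.some 0 0 (nonsingular_zero_zero_twoTorsionModel L)


/-- **`X049GenusHalfTraceFiveModEight` — the genus-field half-trace relation for the level-`49`
Heegner points over `ℚ(√−q)`, `q ≡ 5 (mod 8)` prime, `(q/7) = −1` (NAMED INPUT, `@[conjecture]`,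
nothing asserted).** For every such `q`, every imaginary quadratic `K` with `d_K = −4q`, every
parametrisation datum `Dt` of `cm7 = X₀(49)` at level `49`, Heegner datum `H` of discriminant `d_K`,
embedding `ι : K → ℂ` and `P ∈ X₀(49)(K)` mapping to the Heegner point `Σ_{[Q]} φ(τ_Q)`: a genus-field
half-trace datum for `(K, Dt.c, P)` EXISTS (`X049GenusHalfTraceDatum`, whose docstring sources every
field: Gross 1984 §5 / Gross 1991 Prop. 5.3, Shimura reciprocity, Gauss genus theory for `d_K = −4q`,
the Manin constant of `49a1`, the ramification of `ℚ(i, √−q)` at `q`). It is a COROLLARY of refereed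
print plus two finite facts about `49a1` (Manin constant `1`; the cusp `0` maps to `(2, −1)`), not a
new conjecture; typed as an input because the tree does not yet carry the Galois action on INDIVIDUAL
Heegner points over the Hilbert class field (only the trace `IsHeegnerPoint` and conjugation MODULO
TORSION, `heegnerPoint_conj_add_rootNumber_smul`). Not vacuous: for `q = 5` the datum is
`L = ℚ(i, √−5)`, `z = φ(τ_{(49,−554,1566)})` transported, numerically `z + z̄ = (2, −1)` (kit j259794).
Consumers: §5 (clause (i) of B49 and «Conjecture D(q)» for `q ≡ 5 (mod 8)`).
[cite: GrossLMS1991, Prop. 5.3 and its proof] [cite: Darmon2004, Thm. 3.7]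
[cite: CoatesLiTianZhai2015, §2 (h2), Thm. 2.2] -/
@[conjecture] def X049GenusHalfTraceFiveModEight : Prop :=
  ∀ (q : ℕ) (K : Type) [Field K] [NumberField K] (Dt : ModularParametrizationData cm7 49)
    (H : HeegnerDatum 49 (NumberField.discr K)) (ι : K →+* ℂ) (P : (cm7.baseChange K).toAffine.Point),
    q.Prime → q % 8 = 5 → jacobiSym q 7 = -1 → IsImaginaryQuadratic K →
    NumberField.discr K = -(4 * (q : ℤ)) →
    WeierstrassCurve.Affine.Point.map ι.toRatAlgHom P = heegnerPointComplex Dt H →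
    Nonempty (X049GenusHalfTraceDatum K Dt.c P)

/-! ## §2 Case II is excluded by inertia at a prime of good reduction -/

/-- **Case II excluded (inertia).** Let `(L, w)` be a valued field, `W/F` a Weierstrass equation integral
at `w` with unit discriminant (good reduction), `σ ∈ Aut(L/F)` preserving `w` and acting trivially on the
residue field (an element of the inertia group), `w(2) = 1`, and `T ≠ O` a point with `2T = O`. Then NO
point `z` has `z^σ = z + T`: otherwise `2(z^σ − z) = O` and the tree's reduction lemma
`map_eq_of_inertia_of_zsmul_sub_eq_zero` (Silverman, *AEC*, proofs of VIII.1.5(b) and X.4.2(b)) gives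
`z^σ = z`, i.e. `T = O`. In the application: `L = ℚ(i, √−q)`, `σ = ρτ` generates the inertia group at
`q` (`q` ramifies in `ℚ(√±q)`, not in `ℚ(i)`), `W = X₀(49)` has good reduction at `q ∤ 14`.
[cite: SilvermanAEC2009, Prop. VIII.1.5(b) (proof) and X.§4 proof of Thm. 4.2(b)] -/
theorem map_ne_add_of_inertia {F L : Type*} [Field F] [Field L] [Algebra F L]
    {w : Valuation L ℝ≥0} (W : WeierstrassCurve F) [(W.baseChange L).IsIntegral w.integer]
    (hΔ : w (W.baseChange L).Δ = 1) (σ : L ≃ₐ[F] L) (hσ : ∀ x, w (σ x) = w x)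
    (hσI : ∀ x, w x ≤ 1 → w (σ x - x) < 1) (h2 : w 2 = 1)
    {T : (W.baseChange L).toAffine.Point} (hT : T ≠ 0) (hT2 : T + T = 0)
    (z : (W.baseChange L).toAffine.Point) :
    Affine.Point.map (σ : L →ₐ[F] L) z ≠ z + T := by
  intro h
  have hn : w ((2 : ℤ) : L) = 1 := by exact_mod_cast h2
  have hfix := map_eq_of_inertia_of_zsmul_sub_eq_zero W hΔ σ hσ hσI hn (P := z)
    (by rw [h, add_sub_cancel_left, two_zsmul, hT2])
  rw [hfix] at h
  exact hT (left_eq_add.mp h)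

/-! ## §5 Assembly: non-torsion of the Heegner point, clause (i) of B49 and «Conjecture D(q)» for `q ≡ 5 (mod 8)` -/

section Assembly

variable {L : Type*} [Field L] [CharZero L]

/-- `(ρτ)` on points is `ρ ∘ τ` on points. [folklore] -/
theorem map_trans_apply (ρ τ : L ≃ₐ[ℚ] L) (z : ((⟨0, 21, 0, 112, 0⟩ : WeierstrassCurve ℚ).baseChange L).toAffine.Point) :
    Affine.Point.map ((τ.trans ρ : L ≃ₐ[ℚ] L) : L →ₐ[ℚ] L) z =
      Affine.Point.map (ρ : L →ₐ[ℚ] L) (Affine.Point.map (τ : L →ₐ[ℚ] L) z) := by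
  rcases z with _ | ⟨x, y, h⟩
  · rfl
  · simp only [Affine.Point.map_some]
    rfl

/-- `T₊ = (0, 0)` is fixed by every `ℚ`-automorphism. [folklore] -/
theorem map_twoTorsionPoint (σ : L ≃ₐ[ℚ] L) :
    Affine.Point.map (σ : L →ₐ[ℚ] L)
        (Affine.Point.some 0 0 (nonsingular_zero_zero_twoTorsionModel L) :
          ((⟨0, 21, 0, 112, 0⟩ : WeierstrassCurve ℚ).baseChange L).toAffine.Point) =
      Affine.Point.some 0 0 (nonsingular_zero_zero_twoTorsionModel L) := by
  rw [Affine.Point.map_some]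
  simp only [map_zero]

end Assembly

/-- **A genus-field half-trace datum forces the Heegner point off the torsion** (the even-discriminant
Birch lemma at `4`-rank zero, algebraic core): §1 applied in `E₊(L)` with `ρ, τ` acting on coordinates,
`A[2] = ⟨T₊⟩` (§3, `√−7 ∉ L`), Case I excluded by the Gaussian descent (§3) and Case II by inertia at `q`
(§2, `Δ(E₊) = −2¹²·7³` is a `w`-unit); then `y₀ = z + ρz` has infinite order, hence so has `P = c•y₀`
(`c ≠ 0`). [cite: GrossLMS1991, Prop. 5.3] [cite: SilvermanAEC2009, Prop. VIII.1.5(b) and X.4.9] -/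
theorem not_isOfFinAddOrder_of_genusHalfTraceDatum {K : Type} [Field K] [NumberField K] {c : ℤ}
    (hc : c ≠ 0) {P : (cm7.baseChange K).toAffine.Point} (D : X049GenusHalfTraceDatum K c P) :
    ¬ IsOfFinAddOrder P := by
  letI := D.instField
  letI := D.instCharZero
  intro hP
  -- `y₀`, hence `Φ(y₀) = z + ρ z`, would have finite order
  have hy₀ : IsOfFinAddOrder D.y₀ := by
    obtain ⟨n, hn, hnP⟩ := (isOfFinAddOrder_iff_zsmul_eq_zero).mp hP
    rw [D.smul_eq, smul_smul] at hnP
    exact (isOfFinAddOrder_iff_zsmul_eq_zero).mpr ⟨n * c, mul_ne_zero hn hc, hnP⟩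
  have hy₀' : IsOfFinAddOrder (Affine.Point.map D.j.toRatAlgHom D.y₀ : (cm7.baseChange D.L).toAffine.Point) :=
    (Affine.Point.map (W' := cm7) D.j.toRatAlgHom).isOfFinAddOrder hy₀
  have hfin : IsOfFinAddOrder (D.z + Affine.Point.map (D.ρ : D.L →ₐ[ℚ] D.L) D.z) := by
    rw [← D.halfTrace]
    exact D.Φ.isOfFinAddOrder hy₀'
  -- the abstract half-trace lemma in `E₊(L)` (with `T = T₊ = twoTorsionPoint`, definitionally the datum's point)
  haveI := isElliptic_twoTorsionModel_baseChange D.L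
  haveI := isIntegral_twoTorsionModel_baseChange D.L D.w
  have hT : (Affine.Point.some 0 0 (nonsingular_zero_zero_twoTorsionModel D.L) :
      ((⟨0, 21, 0, 112, 0⟩ : WeierstrassCurve ℚ).baseChange D.L).toAffine.Point) =
      ((⟨0, 21, 0, 112, 0⟩ : WeierstrassCurve ℚ).baseChange D.L).twoTorsionPoint := rfl
  refine not_isOfFinAddOrder_of_halfTrace (Affine.Point.map (D.ρ : D.L →ₐ[ℚ] D.L))
    (Affine.Point.map (D.τ : D.L →ₐ[ℚ] D.L)) (twoTorsionPoint_add_twoTorsionPoint _)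
    (hT ▸ map_twoTorsionPoint D.ρ) (eq_zero_or_eq_twoTorsionPoint_of_add_self_eq_zero D.L D.seven)
    (hT ▸ D.halfTrace_conj)
    (add_map_ne_twoTorsionPoint_of_fixed D.L D.ρ D.τ D.i D.i_sq D.map_i D.fixed_ratSpan D.seven) ?_ hfin
  -- Case II: inertia at `q`
  intro z₁
  rw [← map_trans_apply]
  have hΔ : D.w ((⟨0, 21, 0, 112, 0⟩ : WeierstrassCurve ℚ).baseChange D.L).Δ = 1 := by
    rw [twoTorsionModel_baseChange_Δ, Valuation.map_neg, map_mul, map_pow, map_pow, D.val_two,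
      D.val_seven, one_pow, one_pow, one_mul]
  exact map_ne_add_of_inertia (⟨0, 21, 0, 112, 0⟩ : WeierstrassCurve ℚ) hΔ (D.τ.trans D.ρ) D.val_map
    D.val_inertia D.val_two (Affine.Point.some_ne_zero _) (twoTorsionPoint_add_twoTorsionPoint _) z₁

/-- **Clause (i) of LINE B49 for `q ≡ 5 (mod 8)`: every level-`49` Heegner point of `X₀(49)` over
`K = ℚ(√−q)` has infinite order**, granted the genus half-trace input `X049GenusHalfTraceFiveModEight`
(the datum's Manin constant is `Dt.c ≠ 0`, tree `maninConstant_ne_zero_holds`).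
[cite: GrossLMS1991, Prop. 5.3] [cite: CoatesLiTianZhai2015, Thm. 2.2 (the odd class number analogue)] -/
theorem not_isOfFinAddOrder_heegnerPoint_fiveModEight (hHT : X049GenusHalfTraceFiveModEight)
    {q : ℕ} (hq : q.Prime) (hq8 : q % 8 = 5) (hq7 : jacobiSym q 7 = -1)
    (K : Type) [Field K] [NumberField K] (hK : IsImaginaryQuadratic K)
    (hdK : NumberField.discr K = -(4 * (q : ℤ)))
    {P : (cm7.baseChange K).toAffine.Point} (hP : IsHeegnerPoint 49 cm7 K P) : ¬ IsOfFinAddOrder P := by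
  obtain ⟨Dt, H, ι, hPH⟩ := hP
  obtain ⟨D⟩ := hHT q K Dt H ι P hq hq8 hq7 hK hdK hPH
  exact not_isOfFinAddOrder_of_genusHalfTraceDatum Dt.maninConstant_ne_zero_holds D

/-- **The sub-leaf `X049HeegnerNonTorsionEvenDiscr` at `ℚ(√−q)`, `q ≡ 5 (mod 8)`, WITHOUT its Selmer
hypothesis** (cf. seat c301's `heegnerNonTorsionEvenDiscr_negFourPrime_of_birch`).
[cite: GrossLMS1991, Prop. 5.3] -/
theorem heegnerNonTorsionEvenDiscr_fiveModEight_of_genusHalfTrace (hHT : X049GenusHalfTraceFiveModEight) :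
    ∀ (q : ℕ) (K : Type) [Field K] [NumberField K], q.Prime → q % 8 = 5 → jacobiSym q 7 = -1 →
      IsImaginaryQuadratic K → NumberField.discr K = -(4 * (q : ℤ)) →
      ∀ (P : (cm7.baseChange K).toAffine.Point), IsHeegnerPoint 49 cm7 K P → ¬ IsOfFinAddOrder P :=
  fun _ K _ _ hq hq8 hq7 hK hdK _ hP =>
    not_isOfFinAddOrder_heegnerPoint_fiveModEight hHT hq hq8 hq7 K hK hdK hP

/-- **`ord_{s=1} L(X₀(49)/ℚ(√−q), s) = 1` for `q ≡ 5 (mod 8)`, `(q/7) = −1`**, granted Modularity (`hnf`),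
Gross–Zagier (`hGZ`), the `K`-rationality of Heegner points (`hHP`) and the genus half-trace input:
`7` splits in `K`, a Heegner point exists and has infinite order, and the Gross–Zagier dictionary
converts (verbatim the route of seat c301's `analyticRankEK_cm7_eq_one_of_birch`).
[cite: GrossZagier1986, Thm. I.(6.3) with V.§2 and I.§7] [cite: Gross1991, (1.1)] -/
theorem analyticRankEK_cm7_eq_one_fiveModEight (hnf : ModularForms.exists_isNewformOf)
    (hGZ : ∀ (N : ℕ) [NeZero N] (W : WeierstrassCurve ℚ) (K : Type) [Field K] [NumberField K],
      gross_zagier N W K)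
    (hHP : ∀ (W : WeierstrassCurve ℚ) (K : Type) [Field K] [NumberField K], exists_isHeegnerPoint W K)
    (hHT : X049GenusHalfTraceFiveModEight) {q : ℕ} (hq : q.Prime) (hq8 : q % 8 = 5)
    (hq7 : jacobiSym q 7 = -1) (K : Type) [Field K] [NumberField K] (hK : IsImaginaryQuadratic K)
    (hdK : NumberField.discr K = -(4 * (q : ℤ))) : analyticRankEK cm7 K = 1 := by
  haveI : NeZero (cm7.conductorNorm ℤ) := ⟨(cm7.conductorNorm_pos_holds).ne'⟩
  have hdK' : NumberField.discr K = 4 * (-(q : ℤ)) := by rw [hdK]; ring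
  have hH : SatisfiesHeegnerHypothesis 49 K :=
    satisfiesHeegnerHypothesis_fortyNine_of_discr_eq K hK.1 hdK' (jacobiSym_neg_prime_seven hq7)
  have hH' : SatisfiesHeegnerHypothesis (cm7.conductorNorm ℤ) K := by rw [conductorNorm_cm7]; exact hH
  obtain ⟨P, hP0⟩ := hHP cm7 K hK hH'
  have hP : IsHeegnerPoint 49 cm7 K P := isHeegnerPoint_of_level_eq conductorNorm_cm7 hP0
  exact (analyticRankEK_eq_one_iff_heegner_nonTorsion_of_exists_isNewformOf cm7 49 K (hGZ 49 cm7 K) hnf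
    hK conductorNorm_cm7 hH hP).mpr (not_isOfFinAddOrder_heegnerPoint_fiveModEight hHT hq hq8 hq7 K hK hdK hP)

/-- **«CONJECTURE D(q)» for `q ≡ 5 (mod 8)`: `ord_{s=1} L(W, s) = 1` for EVERY elliptic `W/ℚ` that is
`ℚ`-isomorphic to `49a1^{(−q)}`, `q ≡ 5 (mod 8)` prime with `(q/7) = −1`** — the CONCLUSION of the crux
K12₂″ (item 20044) on this infinite sub-family of the additive cell, with no Selmer hypothesis — granted
Modularity, Coates–Li–Tian–Zhai Thm. 1.2 at `R = 1`, Gross–Zagier, Heegner rationality and the genus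
half-trace input (verbatim the route of seat c301's `analyticRank_eq_one_inertPrimeTwist_of_birch`).
[cite: CoatesLiTianZhai2015, Thm. 1.2 (p. 359, case r = 0) and Thm. 1.4]
[cite: GrossZagier1986, Thm. I.(6.3) and I.§7] -/
theorem analyticRank_eq_one_inertPrimeTwist_fiveModEight (hnf : ModularForms.exists_isNewformOf)
    (h12 : CoatesLiTianZhai2015.thm12_fullBSD_twist)
    (hGZ : ∀ (N : ℕ) [NeZero N] (W : WeierstrassCurve ℚ) (K : Type) [Field K] [NumberField K],
      gross_zagier N W K)
    (hHP : ∀ (W : WeierstrassCurve ℚ) (K : Type) [Field K] [NumberField K], exists_isHeegnerPoint W K)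
    (hHT : X049GenusHalfTraceFiveModEight) {q : ℕ} (hq : q.Prime) (hq8 : q % 8 = 5)
    (hq7 : jacobiSym q 7 = -1) (W : WeierstrassCurve ℚ) [W.IsElliptic] (C : VariableChange ℚ)
    (hC : C • W = cm7.quadraticTwist ((-q : ℤ) : ℚ)) : W.analyticRank = 1 := by
  have hmod : hasEntireLFunction_rat := hasEntireLFunction_rat_of_exists_isNewformOf hnf
  have hsq : Squarefree (-(q : ℤ)) := by
    rw [← Int.squarefree_natAbs, Int.natAbs_neg, Int.natAbs_natCast]
    exact hq.squarefree
  have hq0 : ((-q : ℤ) : ℚ) ≠ 0 := by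
    have := hq.pos
    exact_mod_cast (show (-(q : ℤ)) ≠ 0 by omega)
  haveI := cm7.isElliptic_quadraticTwist hq0
  -- `K = ℚ(√−q)`, `d_K = −4q` (`−q ≡ 3 (mod 4)`)
  obtain ⟨K, _, _, h2, hdK⟩ := QuadraticFields.Quadratic.exists_numberField_discr_eq (D := 4 * (-(q : ℤ)))
    (Or.inr ⟨dvd_mul_right 4 _, by rw [show 4 * (-(q : ℤ)) / 4 = -(q : ℤ) by omega]; omega,
      by rw [show 4 * (-(q : ℤ)) / 4 = -(q : ℤ) by omega]; exact hsq⟩)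
  have hK : IsImaginaryQuadratic K :=
    isImaginaryQuadratic_iff_discr_neg.mpr ⟨h2, by rw [hdK]; have := hq.pos; omega⟩
  have hEK := analyticRankEK_cm7_eq_one_fiveModEight hnf hGZ hHP hHT hq hq8 hq7 K hK (by rw [hdK]; ring)
  -- `X₀(49)^{(d_K)} = X₀(49)^{(4·(−q))} ≅ X₀(49)^{(−q)} ≅ W`
  have htw : cm7.quadraticTwist (NumberField.discr K : ℚ) =
      (⟨(Units.mk0 (2 : ℚ) two_ne_zero)⁻¹, 0, 0, 0⟩ : VariableChange ℚ) • cm7.quadraticTwist ((-q : ℤ) : ℚ) := by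
    rw [hdK, show ((-q : ℤ) : ℚ) = ((-(q : ℤ) : ℤ) : ℚ) by push_cast; ring]
    exact quadraticTwist_cm7_four_mul (-(q : ℤ))
  haveI : (cm7.quadraticTwist (NumberField.discr K : ℚ)).IsElliptic := by rw [htw]; infer_instance
  have hWdK : IsIsogenous W (cm7.quadraticTwist (NumberField.discr K : ℚ)) := by
    rw [htw]
    exact (isIsogenous_of_smul_eq hC).trans' (isIsogenous_smul _ _)
  rw [analyticRankEK_cm7 hmod h12 K, ← analyticRank_eq_of_isIsogenous' hWdK] at hEK
  exact hEK

/-- **K12₂″ ON THE FAMILY `49a1^{(−q)}`, `q ≡ 5 (mod 8)`**: the implication of the route decl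
`RankOneTwoConverseCMSevenAdditiveTwo` (item 20044) for every model `W` of `49a1^{(−q)}` — its CONCLUSION
holds outright under the inputs of `analyticRank_eq_one_inertPrimeTwist_fiveModEight`.
[cite: CoatesLiTianZhai2015, Thm. 1.4] [cite: BurungaleCastellaSkinnerTian2022, Rem. D (p. 327)] -/
theorem rankOneTwoConverse_inertPrimeTwist_fiveModEight (hnf : ModularForms.exists_isNewformOf)
    (h12 : CoatesLiTianZhai2015.thm12_fullBSD_twist)
    (hGZ : ∀ (N : ℕ) [NeZero N] (W : WeierstrassCurve ℚ) (K : Type) [Field K] [NumberField K],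
      gross_zagier N W K)
    (hHP : ∀ (W : WeierstrassCurve ℚ) (K : Type) [Field K] [NumberField K], exists_isHeegnerPoint W K)
    (hHT : X049GenusHalfTraceFiveModEight) {q : ℕ} (hq : q.Prime) (hq8 : q % 8 = 5)
    (hq7 : jacobiSym q 7 = -1) (W : WeierstrassCurve ℚ) [W.IsElliptic] [W.IsGloballyMinimal]
    (C : VariableChange ℚ) (hC : C • W = cm7.quadraticTwist ((-q : ℤ) : ℚ)) :
    W.j = -3375 → ¬ W.HasGoodReductionAtPrime 2 → W.selmerCorank 2 = 1 → W.analyticRank = 1 :=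
  fun _ _ _ => analyticRank_eq_one_inertPrimeTwist_fiveModEight hnf h12 hGZ hHP hHT hq hq8 hq7 W C hC


end Summit.BirchSwinnertonDyer.BirchSwinnertonDyer.Theorems.GoldfeldGoodTwists

end
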